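import Summits.AtomisticToContinuum.FouriersLaw.Theorems.BondHeatUncertaintySubdiffusiveBondHeatJunctionRatioTransferSize

/-!
# BondHeatUncertainty › SubdiffusiveBondHeat › JunctionRatio › TransferBound

Fourth file of the [LM] `TransferMoment` proof: pointwise size control of the hot-end observable.

* `|Φ₁| ≤ kG · m³`, `|LΦ₁| ≤ kGG · m⁴`, `|Ψ_hot(x)| ≤ kPsi(ω₂, λ, β, γ) · m(x)⁴` (`abs_transferObservableHot_le`)
  with `m = hotSize` and explicit polynomial constants `kG, kGG, kPsi` INDEPENDENT of `N` and of `T`;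
* `Ψ_hot² ≤ 2⁴² kPsi² (1 + q₀⁸ + q₁⁸ + q₂⁸ + p₀⁸ + p₁⁸ + p₂⁸)` (`sq_transferObservableHot_le`);
* continuity of `Φ₁`, `LΦ₁`, `Ψ_hot` (§H5).

All [calculus].
-/

noncomputable section

open MeasureTheory Filter Topology Set
open scoped BigOperators

namespace Summit.AtomisticToContinuum.FouriersLaw.Theorems.SubdiffusiveBondHeat

namespace EscapeGrading

open Literature.MathematicalPhysics.KineticTheory.HeatConduction

variable {N : ℕ} {ω₂ lam β γ : ℝ}

/-! ## H4. `|G| ≤ kG m³`, `|GG| ≤ kGG m⁴`, `|Ψ_hot| ≤ kPsi m⁴` -/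

/-- Bound of `|F₁|`, `|F₀|` (forces at sites 1, 0) in units of `m³`. -/
def kF (ω₂ lam β : ℝ) : ℝ := ω₂ + lam + 2 * (1 + β)

/-- Bound of `|L φ₁|` in units of `m³`. -/
def kG (ω₂ lam β : ℝ) : ℝ := (3 * β + 1) + kF ω₂ lam β

/-- Bound of `|L² φ₁|` in units of `m⁴`. -/
def kGG (ω₂ lam β γ : ℝ) : ℝ :=
  18 * β + kF ω₂ lam β * (3 * β + 1) + (1 + 3 * β) + (ω₂ + 3 * lam) + (1 + 3 * β)
    + (3 * β + 1) * (2 * kF ω₂ lam β + (ω₂ + lam + (1 + β))) + γ * (3 * β + 1)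

/-- Bound of `|Ψ_hot|` in units of `m⁴`. -/
def kPsi (ω₂ lam β γ : ℝ) : ℝ :=
  kGG ω₂ lam β γ + γ * kG ω₂ lam β + (ω₂ + 3 * lam + (1 + 3 * β))

/-- `0 ≤ kPsi` for non-negative parameters. [bookkeeping] -/
theorem kPsi_nonneg (hω : 0 ≤ ω₂) (hl : 0 ≤ lam) (hβ : 0 ≤ β) (hγ : 0 ≤ γ) :
    0 ≤ kPsi ω₂ lam β γ := by
  unfold kPsi kGG kG kF; positivity

/-- `|L φ₁(x)| ≤ kG · m(x)³`. [calculus] -/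
theorem abs_genTransferHot_le (hω : 0 ≤ ω₂) (hl : 0 ≤ lam) (hβ : 0 ≤ β) (hN : 3 ≤ N)
    (x : PhaseSpace N) :
    |genTransferHot ω₂ lam β N hN x| ≤ kG ω₂ lam β * hotSize N hN x ^ 3 := by
  have hm := one_le_hotSize hN x
  have hb := bnd_atom (abs_p1_le_hotSize hN x)
  have hba := bnd_atom (abs_dp_le_hotSize hN x)
  have hφ : |transferPhi β (x.1 (site1 hN) - x.1 (site0 hN))| ≤ 1 * hotSize N hN x ^ 0 :=
    bnd_of_le (abs_transferPhi_le hβ _)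
  have hφ' : |transferDPhi β (x.1 (site1 hN) - x.1 (site0 hN))| ≤ (3 * β + 1) * hotSize N hN x ^ 0 :=
    bnd_of_le (abs_transferDPhi_le hβ _)
  have hPF1 := abs_pinForce_le hω hl hm (abs_q1_le_hotSize hN x)
  have hBFr := abs_bondForce_le hβ hm (abs_r_le_hotSize hN x)
  have hBFs := abs_bondForce_le hβ hm (abs_s_le_hotSize hN x)
  have hF1 := bnd_sub (bnd_add hPF1 hBFr) hBFs
  have h1 : |(x.2 (site1 hN) - x.2 (site0 hN)) * x.2 (site1 hN)
      * transferDPhi β (x.1 (site1 hN) - x.1 (site0 hN))| ≤ 1 * 1 * (3 * β + 1) * hotSize N hN x ^ 2 :=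
    bnd_mul (bnd_mul hba hb) hφ'
  have h2 : |_| ≤ _ * hotSize N hN x ^ 3 := bnd_mul hF1 hφ
  have h : |_| ≤ _ * hotSize N hN x ^ 3 := bnd_sub (bnd_lift hm (show 2 ≤ 3 by norm_num) h1) h2
  refine h.trans (le_of_eq ?_)
  simp only [kG, kF]; ring

/-- `|L² φ₁(x)| ≤ kGG · m(x)⁴`. [calculus] -/
theorem abs_genGenTransferHot_le (hω : 0 ≤ ω₂) (hl : 0 ≤ lam) (hβ : 0 ≤ β) (hγ : 0 ≤ γ)
    (hN : 3 ≤ N) (x : PhaseSpace N) :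
    |genGenTransferHot ω₂ lam β γ N hN x| ≤ kGG ω₂ lam β γ * hotSize N hN x ^ 4 := by
  have hm := one_le_hotSize hN x
  have ha := bnd_atom (abs_p0_le_hotSize hN x)
  have hb := bnd_atom (abs_p1_le_hotSize hN x)
  have hba := bnd_atom (abs_dp_le_hotSize hN x)
  have hcb := bnd_atom (abs_dp2_le_hotSize hN x)
  have hφ : |transferPhi β (x.1 (site1 hN) - x.1 (site0 hN))| ≤ 1 * hotSize N hN x ^ 0 :=
    bnd_of_le (abs_transferPhi_le hβ _)
  have hφ' : |transferDPhi β (x.1 (site1 hN) - x.1 (site0 hN))| ≤ (3 * β + 1) * hotSize N hN x ^ 0 :=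
    bnd_of_le (abs_transferDPhi_le hβ _)
  have hφ'' : |transferDDPhi β (x.1 (site1 hN) - x.1 (site0 hN))| ≤ 18 * β * hotSize N hN x ^ 0 :=
    bnd_of_le (abs_transferDDPhi_le hβ _)
  have hPF1 := abs_pinForce_le hω hl hm (abs_q1_le_hotSize hN x)
  have hPF0 := abs_pinForce_le hω hl hm (abs_q0_le_hotSize hN x)
  have hBFr := abs_bondForce_le hβ hm (abs_r_le_hotSize hN x)
  have hBFs := abs_bondForce_le hβ hm (abs_s_le_hotSize hN x)
  have hPS1 := abs_pinStiff_le hω hl hm (abs_q1_le_hotSize hN x)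
  have hBSr := abs_bondStiff_le hβ hm (abs_r_le_hotSize hN x)
  have hBSs := abs_bondStiff_le hβ hm (abs_s_le_hotSize hN x)
  have hF1 := bnd_sub (bnd_add hPF1 hBFr) hBFs
  have hF0 := bnd_sub hPF0 hBFr
  have hγ' : |γ| ≤ γ * hotSize N hN x ^ 0 := bnd_const hγ
  -- T1 = (b - a) * (((b - a) b φ'' - F₁ φ') - V''(r) φ)
  have hI1 : |(x.2 (site1 hN) - x.2 (site0 hN)) * x.2 (site1 hN)
      * transferDDPhi β (x.1 (site1 hN) - x.1 (site0 hN))| ≤ 1 * 1 * (18 * β) * hotSize N hN x ^ 2 :=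
    bnd_mul (bnd_mul hba hb) hφ''
  have hI2 : |_| ≤ _ * hotSize N hN x ^ 3 := bnd_mul hF1 hφ'
  have hI3 : |_| ≤ _ * hotSize N hN x ^ 2 := bnd_mul hBSr hφ
  have hI : |_| ≤ _ * hotSize N hN x ^ 3 := bnd_sub (bnd_sub (bnd_lift hm (show 2 ≤ 3 by norm_num) hI1) hI2)
    (bnd_lift hm (show 2 ≤ 3 by norm_num) hI3)
  have hT1 : |_| ≤ _ * hotSize N hN x ^ 4 := bnd_mul hba hI
  have hT2 : |_| ≤ _ * hotSize N hN x ^ 3 := bnd_mul (bnd_mul hPS1 hφ) hb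
  have hT3 : |_| ≤ _ * hotSize N hN x ^ 3 := bnd_mul (bnd_mul hBSs hφ) hcb
  have hT4a : |_| ≤ _ * hotSize N hN x ^ 4 := bnd_mul (bnd_sub hF1 hF0) hb
  have hT4b : |_| ≤ _ * hotSize N hN x ^ 4 := bnd_mul hba hF1
  have hT4 : |_| ≤ _ * hotSize N hN x ^ 4 := bnd_mul hφ' (bnd_add hT4a hT4b)
  have hT5 : |_| ≤ _ * hotSize N hN x ^ 2 := bnd_mul (bnd_mul (bnd_mul hγ' ha) hb) hφ'
  have h := bnd_add (bnd_sub (bnd_add (bnd_sub hT1 (bnd_lift hm (show 3 ≤ 4 by norm_num) hT2))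
    (bnd_lift hm (show 3 ≤ 4 by norm_num) hT3)) hT4) (bnd_lift hm (show 2 ≤ 4 by norm_num) hT5)
  refine h.trans (le_of_eq ?_)
  simp only [kGG, kF]; ring

/-- **`|Ψ_hot(x)| ≤ kPsi · m(x)⁴`**, uniformly in `N ≥ 3`. [calculus] -/
theorem abs_transferObservableHot_le (hω : 0 ≤ ω₂) (hl : 0 ≤ lam) (hβ : 0 ≤ β) (hγ : 0 ≤ γ)
    (hN : 3 ≤ N) (x : PhaseSpace N) :
    |transferObservableHot ω₂ lam β γ N hN x| ≤ kPsi ω₂ lam β γ * hotSize N hN x ^ 4 := by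
  have hm := one_le_hotSize hN x
  have hb := bnd_atom (abs_p1_le_hotSize hN x)
  have hφ : |transferPhi β (x.1 (site1 hN) - x.1 (site0 hN))| ≤ 1 * hotSize N hN x ^ 0 :=
    bnd_of_le (abs_transferPhi_le hβ _)
  have hPS0 := abs_pinStiff_le hω hl hm (abs_q0_le_hotSize hN x)
  have hBSr := abs_bondStiff_le hβ hm (abs_r_le_hotSize hN x)
  have hγ' : |γ| ≤ γ * hotSize N hN x ^ 0 := bnd_const hγ
  have hGG := abs_genGenTransferHot_le hω hl hβ hγ hN x
  have hG := abs_genTransferHot_le hω hl hβ hN x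
  have h := bnd_add (bnd_sub hGG (bnd_lift hm (show 3 ≤ 4 by norm_num) (bnd_mul hγ' hG)))
    (bnd_lift hm (show 3 ≤ 4 by norm_num) (bnd_mul (bnd_add hPS0 hBSr) (bnd_mul hb hφ)))
  refine h.trans (le_of_eq ?_)
  simp only [kPsi]; ring

/-- `Ψ_hot(x)² ≤ 2⁴² kPsi² (1 + q₀⁸ + q₁⁸ + q₂⁸ + p₀⁸ + p₁⁸ + p₂⁸)`. [calculus] -/
theorem sq_transferObservableHot_le (hω : 0 ≤ ω₂) (hl : 0 ≤ lam) (hβ : 0 ≤ β) (hγ : 0 ≤ γ)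
    (hN : 3 ≤ N) (x : PhaseSpace N) :
    transferObservableHot ω₂ lam β γ N hN x ^ 2 ≤
      2 ^ 42 * kPsi ω₂ lam β γ ^ 2 * (1 + x.1 (site0 hN) ^ 8 + x.1 (site1 hN) ^ 8
        + x.1 (site2 hN) ^ 8 + x.2 (site0 hN) ^ 8 + x.2 (site1 hN) ^ 8 + x.2 (site2 hN) ^ 8) := by
  have h := abs_transferObservableHot_le hω hl hβ hγ hN x
  have h8 := hotSize_pow_eight_le hN x
  have hK := kPsi_nonneg hω hl hβ hγ
  have h2 : transferObservableHot ω₂ lam β γ N hN x ^ 2 ≤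
      (kPsi ω₂ lam β γ * hotSize N hN x ^ 4) ^ 2 := by
    rw [← sq_abs]
    exact pow_le_pow_left₀ (abs_nonneg _) h 2
  have e : (kPsi ω₂ lam β γ * hotSize N hN x ^ 4) ^ 2 =
      kPsi ω₂ lam β γ ^ 2 * hotSize N hN x ^ 8 := by ring
  rw [e] at h2
  have hK2 : 0 ≤ kPsi ω₂ lam β γ ^ 2 := sq_nonneg _
  nlinarith [mul_le_mul_of_nonneg_left h8 hK2]

/-! ## H5. Continuity of `Ψ_hot` -/

/-- `Φ₁ = Lψ` is continuous (`β ≥ 0`). [calculus] -/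
theorem continuous_genTransferHot (hβ : 0 ≤ β) (hN : 3 ≤ N) :
    Continuous (genTransferHot ω₂ lam β N hN) := by
  have h1 := continuous_transferPhi hβ
  have h2 := continuous_transferDPhi hβ
  have h3 := continuous_pinForce ω₂ lam
  have h4 := continuous_bondForce β
  unfold genTransferHot
  fun_prop

/-- `LΦ₁` is continuous (`β ≥ 0`). [calculus] -/
theorem continuous_genGenTransferHot (hβ : 0 ≤ β) (hN : 3 ≤ N) :
    Continuous (genGenTransferHot ω₂ lam β γ N hN) := by
  have h1 := continuous_transferPhi hβ
  have h2 := continuous_transferDPhi hβ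
  have h2' := continuous_transferDDPhi hβ
  have h3 := continuous_pinForce ω₂ lam
  have h4 := continuous_bondForce β
  have h5 := continuous_pinStiff ω₂ lam
  have h6 := continuous_bondStiff β
  unfold genGenTransferHot
  fun_prop

/-- `Ψ_hot` is continuous. [calculus] -/
theorem continuous_transferObservableHot (hβ : 0 ≤ β) (hN : 3 ≤ N) :
    Continuous (transferObservableHot ω₂ lam β γ N hN) := by
  have h1 := continuous_transferPhi hβ
  have h5 := continuous_pinStiff ω₂ lam
  have h6 := continuous_bondStiff β
  have hG := continuous_genTransferHot (ω₂ := ω₂) (lam := lam) hβ hN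
  have hGG := continuous_genGenTransferHot (ω₂ := ω₂) (lam := lam) (γ := γ) hβ hN
  unfold transferObservableHot
  fun_prop

end EscapeGrading

end Summit.AtomisticToContinuum.FouriersLaw.Theorems.SubdiffusiveBondHeat
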